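import Summits.ABC.IUTFork.LDHGenuineStepVSum
import Literature.IUT.LogVolume.GenuineLogThetaPerImageStepV
import HarnessLib

/-!
# The fork at [IUTchIII] Corollary 3.12, L-DH level: `−|log(Θ)|` in the PER-(SLOT-)IMAGE reading (P) for the
# GENUINE datum — [IUTchIV] Thm. 1.10 Step (v) in the TEXT's form at EVERY `d_mod`, and `vol_(P) ≤ vol_(U)`

Record-only file (D-0012) of the abc-iut cell (campaign-S seat abc-iut-S7; abc-iut-plan ruling 2026-08-26T02:51:47Z
"(P)-object", items (b) and (c)); TAKES NO SIDE. Mochizuki, *Inter-universal Teichmüller theory III* (RIMS ms May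
2020), Cor. 3.12 p. 174 («holomorphic hulls of … the unions of the possible images … subject to (Ind1), (Ind2),
(Ind3)» — reading (U)) and its proof, Step (x) p. 181 l. 2–32 («the resulting log-volumes ∈ ℝ are invariant with
respect to the indeterminacies (Ind1), (Ind2), and have the effect of converting the indeterminacy (Ind3) into an
inequality» — reading (P)); *IUT IV* (RIMS ms Apr. 2020), Thm. 1.10 Step (v) p. 27–28 («after symmetrizing with
respect to the choice of i† …»); Dupuy–Hilado, arXiv:2004.13228 §3.9, §4.9–4.12.

For the Dupuy–Hilado datum `ofInput I` of a genuine Θ-volume input `I` (abc-iut-S2's `LDHGenuine`: Mochizuki's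
log-shell normalisation, SHARP (Ind3)-datum, genuine completions `K_{v̲}`) and the per-slot-image region
`hullUThetaSlot` of `GenuineLogThetaPerImage.lean` (the hull of `⋃_{g ∈ G₂(v⃗)} g·O_𝕃(−P_Θ)_{v⃗}` — NO union over
the capsule-index permutations of (Ind1)):
* `lnνLp_hullUThetaSlot_ofInput`, `lnνL_hullUThetaSlot_ofInput` — the DH-level log-volume of `hull(U_Θ^slot)` IS
  the Literature number `negLogThetaPerImageNonarch I` (same bridge as `negLogThetaDH_ofInput`);
* `slotComponentBound_ofInput` — per summand, the TEXT's Step (v) discrepancy `{d_I + 1}·log(p) +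
  Σ_{a∈I*}{3 + log(e_a)}` with `i† := j` and NO slot term, for EVERY collection `v⃗` (mixed or not): the per-image
  bound of `GenuineLogThetaPerImageStepV.lean` transported to the datum;
* `logμ_hullUThetaSlot_ofInput_le_collBound` — hence abc-iut-S3's per-collection `collBound` (the `hvol` shape of
  `Thm110Numerics.LocalProofData`, `q`-term at the distinguished slot `i† = j`) holds for `hull(U_Θ^slot)` WITHOUT
  the slot-constancy hypothesis that `LDHGenuineStepV.logμ_hullUTheta_ofInput_le_collBound` needs for `hull(U_Θ)`;
* `procAvg_wavg_slot_ofInput_le`, `negLogThetaPerImageNonarch_le` — Step (v)'s printed display at a prime and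
  summed over the support primes, text form, every datum;
* **`hullEstimatePerImageOf_ofInput`**, **`hullEstimatePerImageOf_ofInput_explicit`**, `…_of_finrank` free — THE
  CHEAPEST FALSIFIER OF (R3′)'s USEFULNESS LANDS POSITIVELY: `HullEstimatePerImageOf I δ_K` for EVERY genuine input
  with the SAME constant `δ_K = (l+1)/4·{(1+4/l)·Σ_p log(𝔡^K_p) + (4/l)·Σ_p log(𝔰^ℚ_p) + (20/3)·l*_mod·Σ_p ι_p}` that
  `hullEstimateOf_ofInput_of_slotConstant` reaches for reading (U) ONLY under slot-constancy — i.e. in reading (P)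
  the computable half of the route edge (ii′) is a theorem at every `d_mod`, up to the tower arithmetic of
  Steps (ii), (iii) (the (R4)-shape input, other seats);
* `lnνL_hullUThetaSlot_le_negLogThetaDH`, **`negLogThetaPerImageNonarch_le_negLogThetaNonarch`** (`vol_(P) ≤ vol_(U)`:
  the slot hull lies in the full hull, both admissible), hence `cor312Of_of_cor312PerImageOf` ((P) ⟹ (U): the
  (P)-form of Cor. 3.12 is the STRONGER hypothesis), `cor312NonarchOf_of_cor312PerImageNonarchOf`,
  `hullEstimatePerImageOf_of_hullEstimateOf`, and at the Θ-data of a point `Cor22.cor312AtDatum_of_perImage`,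
  `Cor22.hullVolumePerImageAtDatum_of_hullVolumeAtDatum`.
[cite: Mochizuki2012, IUTchIII Cor. 3.12 p. 174] [cite: Mochizuki2012, IUTchIII Cor. 3.12 proof Step (x) p. 181]
[cite: Mochizuki2012, IUTchIV Thm. 1.10 Step (v) p. 27–28] [cite: DupuyHilado2025, §3.9, §4.9, §4.12]
[claim: Mochizuki2012, status: disputed] HONEST SCOPE: nothing asserts Cor. 3.12 in either reading; which number
print's `−|log(Θ)|` denotes is ref-b's locator question; σ-independence of `vol_(P)` (the other slot data give the
same number) is recorded separately; typed ≠ proved; an instance ≠ an endorsement.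
-/

noncomputable section

namespace Summit.ABC.IUTFork

namespace DHData

open Finset Literature.IUT.LogVolume Literature.IUT.LogVolume.Thm110Local NumberField IsDedekindDomain
open scoped Pointwise

variable {F₀ : Type} [Field F₀] [NumberField F₀] {K : Type} [Field K] [NumberField K] [Algebra F₀ K]

/-! ## Evaluation of the assembled datum at a prime (the `dite` of `ofPrimesLine`) -/

section IdelesM

variable (X : PilotData F₀) (𝔽 : LocalFieldFamily F₀)
  (tΘ : ∀ (p : ℕ) (hp : p.Prime), Fin X.lstar → (v : placesOver F₀ p) → (@LocalFields.k F₀ _ _ p ⟨hp⟩ (𝔽 p hp) v)ˣ)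
  (tΘ_ord : ∀ (p : ℕ) (hp : p.Prime) (i : Fin X.lstar) (v : placesOver F₀ p),
    @LocalFields.ordv F₀ _ _ p ⟨hp⟩ (𝔽 p hp) v (tΘ p hp i v) = X.thetaPilot i v.1)
  (tq : ∀ (p : ℕ) (hp : p.Prime), Fin X.lstar → (v : placesOver F₀ p) → (@LocalFields.k F₀ _ _ p ⟨hp⟩ (𝔽 p hp) v)ˣ)
  (tq_ord : ∀ (p : ℕ) (hp : p.Prime) (i : Fin X.lstar) (v : placesOver F₀ p),
    @LocalFields.ordv F₀ _ _ p ⟨hp⟩ (𝔽 p hp) v (tq p hp i v) = X.qPilot v.1)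
  (T : Finset ℕ) (T_prime : ∀ p ∈ T, p.Prime) (S_sub : ∀ v ∈ X.S, residueChar F₀ v ∈ T)

/-- **`ln ν̄_{𝕃_p}(hull(U_Θ^slot)_p)` of the idele-built datum, at a prime `p`, is the slot-hull volume of the REAL
packet at `p`.** [cite: DupuyHilado2025, Def. 3.6.3, §4.12] -/
theorem ofIdelesM_lnνLp_hullUThetaSlot {p : ℕ} (hp : p.Prime) :
    (ofIdelesM X 𝔽 tΘ tΘ_ord tq tq_ord T T_prime S_sub).M.lnνLp X.lstar p
        ((ofIdelesM X 𝔽 tΘ tΘ_ord tq tq_ord T T_prime S_sub).M.hullUThetaSlot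
          (ofIdelesM X 𝔽 tΘ tΘ_ord tq tq_ord T T_prime S_sub).ind3) =
      (@realPrimePacketM F₀ _ _ p ⟨hp⟩ (𝔽 p hp)).lnνLp X.lstar
        ((@realPrimePacketM F₀ _ _ p ⟨hp⟩ (𝔽 p hp)).slotImagesHull
          ((@realPrimePacketM F₀ _ _ p ⟨hp⟩ (𝔽 p hp)).pilotRegion (tΘ p hp))) := by
  set D := ofIdelesM X 𝔽 tΘ tΘ_ord tq tq_ord T T_prime S_sub with hD
  rw [IndPacketModel.lnνLp_eq_primePart]
  have h : D.M.regionAt (D.M.hullUThetaSlot D.ind3) p =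
      (D.M.primePart p).slotImagesHull (D.M.regionAt D.ind3.bare3 p) := by
    funext j e
    exact IndPacketModel.hullUThetaSlot_eq_slotImagesHull _ _ p j e
  rw [h]
  -- evaluate the `dite` of `ofPrimesLine` at the prime `p` (abc-iut-S2's `DHDatum.dite_eval`)
  show (if hp : p.Prime then @realPrimePacketM F₀ _ _ p ⟨hp⟩ (𝔽 p hp) else PrimePacket.line F₀ p).lnνLp X.lstar
      ((if hp : p.Prime then @realPrimePacketM F₀ _ _ p ⟨hp⟩ (𝔽 p hp) else PrimePacket.line F₀ p).slotImagesHull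
        (if hp : p.Prime then
            PrimePacket.DHDatum.transport (dif_pos hp)
              (@PrimePacket.minimalDHDatumM F₀ _ _ p ⟨hp⟩ (𝔽 p hp) X (tΘ p hp) (tΘ_ord p hp) (tq p hp) (tq_ord p hp))
          else PrimePacket.DHDatum.transport (dif_neg hp) (PrimePacket.lineDatum p X) :
          ((if hp : p.Prime then @realPrimePacketM F₀ _ _ p ⟨hp⟩ (𝔽 p hp) else PrimePacket.line F₀ p)).DHDatum X).bare3) = _
  exact PrimePacket.DHDatum.dite_eval (X := X) (p.Prime) hp _ _ _ _
    (fun Q d => Q.lnνLp X.lstar (Q.slotImagesHull d.bare3))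

end IdelesM

variable (I : ThetaVolumeInput F₀ K)

/-! ## `hull(U_Θ^slot)`: the summit-side volume IS the Literature number -/

/-- At a prime `p`, `ln ν̄_{𝕃_p}(hull(U_Θ^slot)_p)` of the datum is the input's local summand `negLogThetaPerImageLoc p`.
[cite: DupuyHilado2025, Def. 3.6.3, §4.12] -/
theorem lnνLp_hullUThetaSlot_ofInput {p : ℕ} (hp : p.Prime) :
    (ofInput I).M.lnνLp I.lstar p ((ofInput I).M.hullUThetaSlot (ofInput I).ind3) = I.negLogThetaPerImageLoc p := by
  rw [I.negLogThetaPerImageLoc_of_prime hp]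
  exact ofIdelesM_lnνLp_hullUThetaSlot I.X I.σ.localFieldFamily I.tΘ I.tΘ_ord I.tq I.tq_ord I.supportPrimes
    (fun _ hp => I.prime_of_mem_supportPrimes hp) (fun _ hv => I.residueChar_mem_supportPrimes hv) hp

/-- **`ln ν̄_𝕃(hull(U_Θ^slot)) = negLogThetaPerImageNonarch I`**: the DH-level log-volume of the per-slot-image hull
of the datum of the input is the nonarchimedean part of the Literature-level `−|log(Θ)|_(P)`.
[cite: Mochizuki2012, IUTchIII Cor. 3.12 proof Step (x) p. 181] -/
theorem lnνL_hullUThetaSlot_ofInput :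
    (ofInput I).M.lnνL I.X.lstar I.supportPrimes ((ofInput I).M.hullUThetaSlot (ofInput I).ind3) =
      I.negLogThetaPerImageNonarch := by
  rw [ThetaVolumeInput.negLogThetaPerImageNonarch, PacketModel.lnνL]
  refine Finset.sum_congr rfl fun p hp => ?_
  exact lnνLp_hullUThetaSlot_ofInput I (I.prime_of_mem_supportPrimes hp)

/-! ## Step (v) per summand for ONE slot datum: the text's discrepancy, every collection -/

/-- **The per-image Step (v) bound for the genuine datum, per summand**: in every degree `j = i+1 ≤ ℓ⋇` and for EVERY
collection `v⃗ ∈ V(F₀)_p^{j+1}`, the `(p,j,v⃗)`-component of `hull(U_Θ^slot)` of `ofInput I` is admissible and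
`log μ̄(hull(U_Θ^slot)_{v⃗}) ≤ log μ̄(O_𝕃(−P_Θ)_{v⃗}) + {d_I + 1}·log(p) + Σ_{a∈I*}{3 + log(e_a)}` — the TEXT's
discrepancy with the distinguished index `i† = j`, NO slot term (compare c312-d1's `componentBound_ofIdelesM` for the
full hull, which carries `θ(v_j) − min_a θ(v_a)`). Inputs: [IUTchIV] Prop. 1.2 (ii) by `prop12ii_holds`, sharpness by
`ofInput_sharp`. [cite: Mochizuki2012, IUTchIV Thm 1.10 proof Step (v) p.27–28] [claim: Mochizuki2012, status: disputed] -/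
theorem slotComponentBound_ofInput {p : ℕ} [hp : Fact p.Prime] (i : Fin I.X.lstar)
    (e : Fin ((i : ℕ) + 1 + 1) → placesOver F₀ p) (Istar : Finset (Fin ((i : ℕ) + 1 + 1)))
    (htame : ∀ a, a ∉ Istar → absRamificationIdx p ((I.σ.localFieldFamily p hp.out).k (e a)) ≤ p - 2) :
    (ofInput I).M.adm ((ofInput I).M.hullUThetaSlot (ofInput I).ind3 p ((i : ℕ) + 1) e) ∧
      (ofInput I).M.logμ ((ofInput I).M.hullUThetaSlot (ofInput I).ind3 p ((i : ℕ) + 1) e) ≤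
        (ofInput I).M.logμ ((ofInput I).M.region (ofInput I).tΘ p ((i : ℕ) + 1) e)
          + ((dSum p (fun a => (I.σ.localFieldFamily p hp.out).k (e a)) + 1) * Real.log p
              + ∑ a ∈ Istar, (3 + Real.log (absRamificationIdx p ((I.σ.localFieldFamily p hp.out).k (e a))))) := by
  have hQ : (ofInput I).M.primePart p = realPrimePacketWith p (I.σ.localFieldFamily p hp.out)
      (mScale p (I.σ.localFieldFamily p hp.out)) (mScale_ne_zero p (I.σ.localFieldFamily p hp.out))
      (mScale_perm p (I.σ.localFieldFamily p hp.out)) :=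
    primePart_tensorPacketModelM I.σ.localFieldFamily hp.out
  rw [IndPacketModel.hullUThetaSlot_eq_slotImagesHull, IndPacketModel.region_eq_regionOf_apply]
  have hB : ((ofInput I).M.primePart p).pilotRegion (fun i v => (ofInput I).tΘ i p v) ((i : ℕ) + 1) e ⊆
      (ofInput I).M.regionAt (ofInput I).ind3.bare3 p ((i : ℕ) + 1) e :=
    (ofInput I).ind3.region_subset p _ e
  have hsharp : (ofInput I).M.regionAt (ofInput I).ind3.bare3 p ((i : ℕ) + 1) e ⊆
      ((ofInput I).M.primePart p).pilotRegion (fun i v => (ofInput I).tΘ i p v) ((i : ℕ) + 1) e :=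
    ofInput_bare3_subset_region I hp.out _ e
  exact PrimePacket.slotComponentBound_of_eq_with (I.σ.localFieldFamily p hp.out) _ _ _
    ((ofInput I).M.primePart p) hQ (fun i v => (ofInput I).tΘ i p v) i e (prop12ii_holds p _)
    ((ofInput I).M.regionAt (ofInput I).ind3.bare3 p) hB hsharp Istar htame

/-! ## The per-collection bound in abc-iut-S3's `collBound` currency — NO slot-constancy -/

/-- **Step (v) per collection for the genuine datum in reading (P), the TEXT's form (`i† = j`), at EVERY `d_mod`**:
for local data `Dl` on `V(F₀)_p` dominating the genuine quantities (`d(K_{v̲})·log p ≤ log(𝔡^K_v)`, `log(q_v) ≤` the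
canonical value, `log p ≤ log(𝔰^ℚ_p)`) and the (R4)-shape input, every component of `hull(U_Θ^slot)` of `ofInput I`
in degree `1 ≤ j ≤ ℓ⋇` is `≤` abc-iut-S3's `collBound` — WITHOUT the hypothesis `hconst` (slot-constant theta values)
of `LDHGenuineStepV.logμ_hullUTheta_ofInput_le_collBound`. [cite: Mochizuki2012, IUTchIV Thm. 1.10 Step (v) p. 27–28]
[claim: Mochizuki2012, status: disputed] -/
theorem logμ_hullUThetaSlot_ofInput_le_collBound {p : ℕ} [hp : Fact p.Prime] (Dl : DstLocal (placesOver F₀ p))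
    {lmod : ℝ} (hlmod : 0 ≤ lmod)
    (hDK : ∀ v : placesOver F₀ p,
      differentOrd p ((I.σ.localFieldFamily p hp.out).k v) * Real.log p ≤ Dl.logDK v)
    (hQ : ∀ v : placesOver F₀ p, Dl.logQ v ≤ (ofInput I).logQloc p v)
    (hlogp : Real.log p ≤ Dl.logp)
    (hR4 : ∀ v : placesOver F₀ p, p - 2 < absRamificationIdx p ((I.σ.localFieldFamily p hp.out).k v) →
      3 + Real.log (absRamificationIdx p ((I.σ.localFieldFamily p hp.out).k v)) ≤ 4 * Dl.iota * lmod)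
    {j : ℕ} (hj : 1 ≤ j) (hjl : j ≤ I.X.lstar) (e : Fin (j + 1) → placesOver F₀ p) :
    (ofInput I).M.logμ ((ofInput I).M.hullUThetaSlot (ofInput I).ind3 p j e) ≤
      DstLocal.collBound Dl (I.X.l : ℝ) lmod j e := by
  obtain ⟨i, rfl⟩ : ∃ i : ℕ, j = i + 1 := ⟨j - 1, by omega⟩
  have hi : i < I.X.lstar := by omega
  set Istar := Finset.univ.filter
    (fun a => p - 2 < absRamificationIdx p ((I.σ.localFieldFamily p hp.out).k (e a))) with hIstar
  have hcb := slotComponentBound_ofInput I ⟨i, hi⟩ e Istar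
    (fun a ha => by
      rw [hIstar, Finset.mem_filter, not_and] at ha
      exact Nat.le_of_not_lt (ha (Finset.mem_univ a)))
  obtain ⟨-, hcb⟩ := hcb
  change (ofInput I).M.logμ ((ofInput I).M.hullUThetaSlot (ofInput I).ind3 p (i + 1) e) ≤
    (ofInput I).M.logμ ((ofInput I).M.region (ofInput I).tΘ p (i + 1) e) + _ at hcb
  rw [logμ_regionΘ_ofInput I ⟨i, hi⟩ p e] at hcb
  -- (1) the theta value at the distinguished (last) slot dominates `(j²/2l)·log(q_{v_j})`
  have hcoef : 0 ≤ (((i : ℕ) : ℝ) + 1) ^ 2 / (2 * I.X.l) := by positivity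
  have hθ : (((i : ℕ) : ℝ) + 1) ^ 2 / (2 * I.X.l) * Dl.logQ (e (Fin.last _)) ≤
      I.X.thetaPilot ⟨i, hi⟩ (e (Fin.last _)).1 * logNorm F₀ (e (Fin.last _)).1 / localDegree F₀ (e (Fin.last _)).1 := by
    rw [thetaValue_eq I ⟨i, hi⟩ (e (Fin.last _))]
    exact mul_le_mul_of_nonneg_left (hQ (e (Fin.last _))) hcoef
  -- (2) the different term
  have hdiff : dSum p (fun a => (I.σ.localFieldFamily p hp.out).k (e a)) * Real.log p ≤
      ∑ a, Dl.logDK (e a) := by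
    rw [dSum, Finset.sum_mul]
    exact Finset.sum_le_sum fun a _ => hDK (e a)
  -- (3) the tameness term via the (R4)-shape input
  have hιl : 0 ≤ 4 * Dl.iota * lmod := by
    have := Dl.iota_nonneg; positivity
  have hram : (∑ a ∈ Istar,
      (3 + Real.log (absRamificationIdx p ((I.σ.localFieldFamily p hp.out).k (e a))))) ≤
      4 * ((((i + 1 : ℕ) : ℝ)) + 1) * Dl.iota * lmod := by
    refine (Finset.sum_le_sum fun a ha => hR4 (e a) (Finset.mem_filter.mp ha).2).trans ?_
    have hcard : (Istar.card : ℝ) ≤ ((i + 1 : ℕ) : ℝ) + 1 := by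
      have h1 : Istar.card ≤ i + 1 + 1 :=
        (Finset.card_le_univ Istar).trans_eq (Fintype.card_fin (i + 1 + 1))
      exact_mod_cast h1
    rw [Finset.sum_const, nsmul_eq_mul]
    nlinarith
  -- assemble
  unfold DstLocal.collBound
  push_cast at hcb hram hθ ⊢
  linarith [Dl.logp_nonneg, hlogp]

/-- **The TEXT's form, procession-normalised, at a prime, in reading (P) — every datum** (abc-iut-S3's
`procAvg_wavg_le` fed with `logμ_hullUThetaSlot_ofInput_le_collBound`): `(1/ℓ⋇)·Σ_j wavg_{v⃗} log μ̄(hull(U_Θ^slot)_{p,j,v⃗})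
≤ (l+1)/4·{(1+4/l)·log(𝔡^K_p) − (1/6)·log(q_p) + (4/l)·log(𝔰^ℚ_p) + (20/3)·ι_p·l*_mod}` — the final display of Step (v)
(p. 29), with NO slot-constancy hypothesis. [cite: Mochizuki2012, IUTchIV Thm. 1.10 Step (v) p. 29] [claim: Mochizuki2012, status: disputed] -/
theorem procAvg_wavg_slot_ofInput_le {p : ℕ} [hp : Fact p.Prime] (Dl : DstLocal (placesOver F₀ p))
    {lmod : ℝ} (hlmod : 0 ≤ lmod)
    (hDK : ∀ v : placesOver F₀ p,
      differentOrd p ((I.σ.localFieldFamily p hp.out).k v) * Real.log p ≤ Dl.logDK v)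
    (hQ : ∀ v : placesOver F₀ p, Dl.logQ v ≤ (ofInput I).logQloc p v)
    (hlogp : Real.log p ≤ Dl.logp)
    (hR4 : ∀ v : placesOver F₀ p, p - 2 < absRamificationIdx p ((I.σ.localFieldFamily p hp.out).k v) →
      3 + Real.log (absRamificationIdx p ((I.σ.localFieldFamily p hp.out).k v)) ≤ 4 * Dl.iota * lmod) :
    procAvg I.X.lstar (fun j => Dl.wavg (j + 1)
        (fun e => (ofInput I).M.logμ ((ofInput I).M.hullUThetaSlot (ofInput I).ind3 p j e))) ≤
      ((I.X.l : ℝ) + 1) / 4 * ((1 + 4 / (I.X.l : ℝ)) * Dl.avg Dl.logDK - 1 / 6 * Dl.avg Dl.logQ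
          + 4 / (I.X.l : ℝ) * Dl.logp + 20 / 3 * (Dl.iota * lmod)) := by
  haveI := nonempty_placesOver (F := F₀) p
  have h := Dl.procAvg_wavg_le I.X.two_le_lstar hlmod
    (fun j e => (ofInput I).M.logμ ((ofInput I).M.hullUThetaSlot (ofInput I).ind3 p j e))
    (fun j hj1 hj2 e => by
      rw [← I.X.l_cast]
      exact logμ_hullUThetaSlot_ofInput_le_collBound I Dl hlmod hDK hQ hlogp hR4 hj1 hj2 e)
  rw [← I.X.l_cast] at h
  exact h

/-! ## Summed over the support primes: the computable half in reading (P), every datum -/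

/-- Rearranging a sum of the per-prime brackets (text's form). [folklore] -/
private theorem sum_bracket'' {ι : Type*} (s : Finset ι) (a b c d : ι → ℝ) (C k₁ k₂ k₃ k₄ : ℝ) :
    ∑ v ∈ s, C * (k₁ * a v - k₂ * b v + k₃ * c v + k₄ * d v) =
      C * (k₁ * ∑ v ∈ s, a v - k₂ * ∑ v ∈ s, b v + k₃ * ∑ v ∈ s, c v + k₄ * ∑ v ∈ s, d v) := by
  rw [Finset.mul_sum, Finset.mul_sum, Finset.mul_sum, Finset.mul_sum, ← Finset.sum_sub_distrib,
    ← Finset.sum_add_distrib, ← Finset.sum_add_distrib, Finset.mul_sum]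

/-- **Steps (v)–(viii) for the genuine datum in reading (P), the TEXT's form, at EVERY `d_mod`**:
`negLogThetaPerImageNonarch I ≤ (l+1)/4·{(1+4/l)·Σ_p log(𝔡^K_p) − (1/6)·Σ_p log(q_p) + (4/l)·Σ_p log(𝔰^ℚ_p) +
(20/3)·l*_mod·Σ_p ι_p}` — the sum over `v_ℚ ∈ 𝕍_ℚ^non` of the printed "procession-normalized upper bounds" (p. 29–30),
with NO slot-constancy hypothesis (compare `negLogThetaNonarch_le_of_slotConstant` for reading (U)).
[cite: Mochizuki2012, IUTchIV Thm. 1.10 Steps (v)–(viii) p. 27–30] [claim: Mochizuki2012, status: disputed] -/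
theorem negLogThetaPerImageNonarch_le (Dloc : (p : ℕ) → DstLocal (placesOver F₀ p))
    {lmod : ℝ} (hlmod : 0 ≤ lmod)
    (hDK : ∀ (p : ℕ) [hp : Fact p.Prime], p ∈ I.supportPrimes → ∀ v : placesOver F₀ p,
      differentOrd p ((I.σ.localFieldFamily p hp.out).k v) * Real.log p ≤ (Dloc p).logDK v)
    (hQ : ∀ p ∈ I.supportPrimes, ∀ v : placesOver F₀ p, (Dloc p).logQ v ≤ (ofInput I).logQloc p v)
    (hlogp : ∀ p ∈ I.supportPrimes, Real.log p ≤ (Dloc p).logp)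
    (hR4 : ∀ (p : ℕ) [hp : Fact p.Prime], p ∈ I.supportPrimes → ∀ v : placesOver F₀ p,
      p - 2 < absRamificationIdx p ((I.σ.localFieldFamily p hp.out).k v) →
      3 + Real.log (absRamificationIdx p ((I.σ.localFieldFamily p hp.out).k v)) ≤ 4 * (Dloc p).iota * lmod)
    (hlam : ∀ p ∈ I.supportPrimes, ∀ v : placesOver F₀ p, (Dloc p).lam v = localDegree F₀ v.1) :
    I.negLogThetaPerImageNonarch ≤
      ((I.X.l : ℝ) + 1) / 4 * ((1 + 4 / (I.X.l : ℝ)) * (∑ p ∈ I.supportPrimes, (Dloc p).avg (Dloc p).logDK)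
          - 1 / 6 * (∑ p ∈ I.supportPrimes, (Dloc p).avg (Dloc p).logQ)
          + 4 / (I.X.l : ℝ) * (∑ p ∈ I.supportPrimes, (Dloc p).logp)
          + 20 / 3 * lmod * (∑ p ∈ I.supportPrimes, (Dloc p).iota)) := by
  rw [← lnνL_hullUThetaSlot_ofInput]
  have h0 : (ofInput I).M.lnνL I.X.lstar I.supportPrimes ((ofInput I).M.hullUThetaSlot (ofInput I).ind3) =
      ∑ p ∈ I.supportPrimes, procAvg I.X.lstar (fun j =>
        @DstLocal.wavg _ _ (Dloc p) (j + 1)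
          (fun e => (ofInput I).M.logμ ((ofInput I).M.hullUThetaSlot (ofInput I).ind3 p j e))) :=
    (ofInput I).M.lnνL_eq_sum_procAvg_wavg I.X.lstar I.supportPrimes (fun _ hp => I.prime_of_mem_supportPrimes hp)
      Dloc hlam _
  rw [h0]
  have hsum : (∑ p ∈ I.supportPrimes, procAvg I.X.lstar (fun j => (Dloc p).wavg (j + 1)
        (fun e => (ofInput I).M.logμ ((ofInput I).M.hullUThetaSlot (ofInput I).ind3 p j e)))) ≤
      ∑ p ∈ I.supportPrimes, ((I.X.l : ℝ) + 1) / 4 * ((1 + 4 / (I.X.l : ℝ)) * (Dloc p).avg (Dloc p).logDK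
          - 1 / 6 * (Dloc p).avg (Dloc p).logQ
          + 4 / (I.X.l : ℝ) * (Dloc p).logp + 20 / 3 * ((Dloc p).iota * lmod)) := by
    refine Finset.sum_le_sum fun p hp => ?_
    haveI : Fact p.Prime := ⟨I.prime_of_mem_supportPrimes hp⟩
    exact procAvg_wavg_slot_ofInput_le I (Dloc p) hlmod (hDK p hp) (hQ p hp) (hlogp p hp) (hR4 p hp)
  refine hsum.trans (le_of_eq ?_)
  have e1 : (fun p => ((I.X.l : ℝ) + 1) / 4 * ((1 + 4 / (I.X.l : ℝ)) * (Dloc p).avg (Dloc p).logDK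
          - 1 / 6 * (Dloc p).avg (Dloc p).logQ
          + 4 / (I.X.l : ℝ) * (Dloc p).logp + 20 / 3 * ((Dloc p).iota * lmod))) =
      fun p => ((I.X.l : ℝ) + 1) / 4 * ((1 + 4 / (I.X.l : ℝ)) * (Dloc p).avg (Dloc p).logDK
          - 1 / 6 * (Dloc p).avg (Dloc p).logQ
          + 4 / (I.X.l : ℝ) * (Dloc p).logp + (20 / 3 * lmod) * (Dloc p).iota) := by
    funext p; ring
  rw [e1, sum_bracket'']

/-- **THE COMPUTABLE HALF IN READING (P), TEXT's SHAPE, AT EVERY `d_mod`** (the cheapest falsifier of (R3′)'s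
usefulness, abc-iut-plan 02:51:47Z (2)(c), LANDS POSITIVELY): with the canonical `log(q_v)` EXACTLY,
`HullEstimatePerImageOf I δ_K` HOLDS with the SAME constant
`δ_K = (l+1)/4·{(1+4/l)·Σ_{p∈T(I)} log(𝔡^K_p) + (4/l)·Σ_{p∈T(I)} log(𝔰^ℚ_p) + (20/3)·l*_mod·Σ_{p∈T(I)} ι_p}` that
`hullEstimateOf_ofInput_of_slotConstant` reaches for reading (U) only under slot-constancy — for EVERY genuine input,
mixed collections included. [cite: Mochizuki2012, IUTchIV Thm. 1.10 Steps (v)–(viii) p. 27–30] [claim: Mochizuki2012, status: disputed] -/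
theorem hullEstimatePerImageOf_ofInput (Dloc : (p : ℕ) → DstLocal (placesOver F₀ p))
    {lmod : ℝ} (hlmod : 0 ≤ lmod)
    (hDK : ∀ (p : ℕ) [hp : Fact p.Prime], p ∈ I.supportPrimes → ∀ v : placesOver F₀ p,
      differentOrd p ((I.σ.localFieldFamily p hp.out).k v) * Real.log p ≤ (Dloc p).logDK v)
    (hQ : ∀ p ∈ I.supportPrimes, ∀ v : placesOver F₀ p, (Dloc p).logQ v = (ofInput I).logQloc p v)
    (hlogp : ∀ p ∈ I.supportPrimes, Real.log p ≤ (Dloc p).logp)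
    (hR4 : ∀ (p : ℕ) [hp : Fact p.Prime], p ∈ I.supportPrimes → ∀ v : placesOver F₀ p,
      p - 2 < absRamificationIdx p ((I.σ.localFieldFamily p hp.out).k v) →
      3 + Real.log (absRamificationIdx p ((I.σ.localFieldFamily p hp.out).k v)) ≤ 4 * (Dloc p).iota * lmod)
    (hlam : ∀ p ∈ I.supportPrimes, ∀ v : placesOver F₀ p, (Dloc p).lam v = localDegree F₀ v.1) :
    I.HullEstimatePerImageOf
      (((I.X.l : ℝ) + 1) / 4 * ((1 + 4 / (I.X.l : ℝ)) * (∑ p ∈ I.supportPrimes, (Dloc p).avg (Dloc p).logDK)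
          + 4 / (I.X.l : ℝ) * (∑ p ∈ I.supportPrimes, (Dloc p).logp)
          + 20 / 3 * lmod * (∑ p ∈ I.supportPrimes, (Dloc p).iota))) := by
  have h := negLogThetaPerImageNonarch_le I Dloc hlmod hDK (fun p hp v => (hQ p hp v).le) hlogp hR4 hlam
  have hq : ∑ p ∈ I.supportPrimes, (Dloc p).avg (Dloc p).logQ = FinDivisor.ndeg F₀ I.X.qDivisor :=
    (ofInput I).sum_avg_logQ_eq_ndeg (fun _ hp => I.prime_of_mem_supportPrimes hp)
      (fun _ hv => I.residueChar_mem_supportPrimes hv) Dloc hlam hQ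
  unfold ThetaVolumeInput.HullEstimatePerImageOf
  rw [ndegLgp_thetaPilot_eq]
  rw [hq] at h
  linarith

/-! ## `vol_(P) ≤ vol_(U)`: (P) is the stronger hypothesis, every (U)-estimate is a (P)-estimate -/

/-- **`ln ν̄_𝕃(hull(U_Θ^slot)) ≤ ln ν̄_𝕃(hull(U_Θ)) = −|log(Θ)|_DH`** for the genuine datum: the slot hull lies in the full
hull componentwise (`hullUThetaSlot_subset_hullUTheta`), both are admissible in the summed degrees (the slot hull by
`slotComponentBound_ofInput`, the full hull by the datum's `hull_adm`), and `log μ̄` is monotone.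
[cite: Mochizuki2012, IUTchIII Cor. 3.12 proof Step (x) p. 181] -/
theorem lnνL_hullUThetaSlot_le_negLogThetaDH :
    (ofInput I).M.lnνL I.X.lstar I.supportPrimes ((ofInput I).M.hullUThetaSlot (ofInput I).ind3) ≤
      (ofInput I).negLogThetaDH := by
  unfold negLogThetaDH PacketModel.lnνL PacketModel.lnνLp PacketModel.lnνTensorPower
  refine Finset.sum_le_sum fun p hp => mul_le_mul_of_nonneg_left
    (Finset.sum_le_sum fun i _ => Finset.sum_le_sum fun e _ =>
      mul_le_mul_of_nonneg_right ?_ (Finset.prod_nonneg fun k _ => weight_nonneg F₀ (e k).1)) ?_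
  · classical
    haveI hp' : Fact p.Prime := ⟨I.prime_of_mem_supportPrimes hp⟩
    have hadm := (slotComponentBound_ofInput I i e
      (Finset.univ.filter (fun a => p - 2 < absRamificationIdx p ((I.σ.localFieldFamily p hp'.out).k (e a))))
      (fun a ha => by
        rw [Finset.mem_filter, not_and] at ha
        exact Nat.le_of_not_lt (ha (Finset.mem_univ a)))).1
    exact (ofInput I).M.logμ_mono hadm ((ofInput I).hull_adm p _ e)
      (IndPacketModel.hullUThetaSlot_subset_hullUTheta _ _ p _ e)
  · positivity

end DHData

end Summit.ABC.IUTFork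

end
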